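import Mathlib
import Literature.Analysis.FluidPDE.TypeIAncientMild
import Summits.NavierStokesRegularity.NavierStokesRegularity.Theses.SymmetryModuliCount
import HarnessLib

/-!
# Crux `ForcedSymmetry` (stmt-NavierStokesRegularity-4052) — STRATEGIST SIGNATURES (typed forms used in
# `Cruxes/ForcedSymmetry/STRATEGY-CENSUS.md`; nothing here is filed as an item)

Crux-strategist `planner-cstrat-stmt-NavierStokesRegularity-4052-0`, 2026-08-16. Each `def … : Prop` is the
typed form of one census attempt, over existing declarations only (`IsTypeIAncientMild` = the route class
`A_C`, `isTypeIAncientMild_iff`; `curl`, `vorticityDirection`, `frobeniusNormSq`, `timeDeriv` as in the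
route decl `StretchingCertificateComparison`). The two `theorem`s are the elementary logical relations the
census quotes; everything analytic is left as a named `Prop`.

* §Strengthen S1 — `ThresholdRigidity` (S⁺) and `ThresholdReduction` (the provable support `S⁺ → X`,
  stated, not proved: compactness of `A_C` + scaling/translation invariance + small-`C` Liouville).
* §Transfer T1 / §Decomposition D2 — `GaussianStretchingCertificate` (provable now from the LANDED
  comparison theorem stmt-14340; recommendation R3) and `FarPastInnerSubcriticality` (the honest residual of
  lever C: X-strength, a statement about tangent flows at `−∞` in stretching currency).
* §Decomposition D1 — `RecurrentSelection` (provable: Birkhoff recurrence in the compact class) and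
  `RecurrentLiouville` (X-strength), the bottom rung of the selection/Liouville ladder.
-/

noncomputable section

-- the summit and its single sub-problem share the name (CONVENTIONS §1)
set_option linter.dupNamespace false

namespace Summit.NavierStokesRegularity.NavierStokesRegularity.Cruxes.ForcedSymmetry.StrategistSignatures

open Literature.Analysis.FluidPDE Filter Topology
open Summit.NavierStokesRegularity.NavierStokesRegularity.Theses.SymmetryModuliCount

/-- §S1. **Threshold rigidity (S⁺).** If `C > 0` is a THRESHOLD constant — every class `A_{C'}` with
`C' < C` is `{0}` — then no element of `A_C` attains the Type-I bound at the interior anchor `(−1, 0)`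
(`‖u(−1,0)‖ = C`). Census: `X ↔ ThresholdRigidity` by compactness (the good set of constants is open;
a minimal bad constant carries an extremal, far-past–saturating element), and extremality is FREE for
every u.s.c. scale-invariant functional on the compact class, so S⁺ buys no rigidity for this step. -/
def ThresholdRigidity : Prop :=
  ∀ C : ℝ, 0 < C →
    (∀ C' : ℝ, C' < C → ∀ u : ℝ → EuclideanSpace ℝ (Fin 3) → EuclideanSpace ℝ (Fin 3),
      IsTypeIAncientMild C' u → ∀ t < 0, ∀ x, u t x = 0) →
    ∀ u : ℝ → EuclideanSpace ℝ (Fin 3) → EuclideanSpace ℝ (Fin 3),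
      IsTypeIAncientMild C u → ‖u (-1) 0‖ = C → False

/-- §S1 support (provable, M): threshold rigidity implies the target. Proof plan: if some `A_C ≠ {0}`,
let `C* := inf {C : A_C ≠ {0}} ≥ ε₀ > 0` (small-`C` Liouville `exists_typeIAncientMild_eq_zero_of_small`);
openness of `{C : A_C = {0}}` (compactness `exists_tendsto_of_isTypeIAncientMild_seq` + continuity of
point evaluation + `M(C) := sup_{A_C} ‖u(−1,0)‖` attained and a fixed point) gives a non-zero
`u* ∈ A_{C*}` with `‖u*(−1,0)‖ = C*`, contradicting `ThresholdRigidity` at `C*`. -/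
def ThresholdReduction : Prop := ThresholdRigidity → TypeIAncientLiouville

/-- The converse is trivial: under `X` every class is `{0}`, and `‖0‖ = C > 0` is absurd. -/
theorem thresholdRigidity_of_typeIAncientLiouville (hX : TypeIAncientLiouville) : ThresholdRigidity := by
  intro C hC _ u hu hnorm
  have h0 : u (-1) 0 = 0 := hX C u (isTypeIAncientMild_iff.1 hu) (-1) (by norm_num) 0
  rw [h0, norm_zero] at hnorm
  exact absurd hnorm (ne_of_lt hC)

/-- The aligned-stretching potential of lever C at `(t, x)` (where `curl u ≠ 0`):
`w = (−t)(⟪∇u ξ, ξ⟫ − |∇ξ|²_F)`, `ξ = curl u/|curl u|` — verbatim the expression inside the route decl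
`StretchingCertificateComparison`. -/
def stretchW (u : ℝ → EuclideanSpace ℝ (Fin 3) → EuclideanSpace ℝ (Fin 3)) (t : ℝ)
    (x : EuclideanSpace ℝ (Fin 3)) : ℝ :=
  (-t) * (inner ℝ (fderiv ℝ (u t) x (vorticityDirection (curl (u t)) x)) (vorticityDirection (curl (u t)) x)
    - frobeniusNormSq (fderiv ℝ (vorticityDirection (curl (u t))) x))

/-- §T1/§D2. **Gaussian stretching certificate** (provable NOW, M, from the landed comparison theorem
stmt-14340 with `h = exp(a|x|²/(−t))`, `a = a(ε, C)` small: the Ornstein–Uhlenbeck confinement `y/2`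
absorbs any bounded stretching outside ONE similarity ball): if the aligned stretching is `ε`-subcritical,
`w ≤ 1 − ε`, on the inner paraboloid `{‖x‖ ≤ R√(−t), curl u ≠ 0}` for ALL `t < 0`, then `u ≡ 0`. The only
"non-symmetric certificate" available today (judge: what_would_move_it (b)); its contrapositive is the
structure theorem "a non-zero element carries ε-critical aligned stretching inside every backward
paraboloid". Recommendation R3: file as a support item. -/
def GaussianStretchingCertificate : Prop :=
  ∀ C ε : ℝ, 0 < ε → ∃ R : ℝ, 0 < R ∧
    ∀ u : ℝ → EuclideanSpace ℝ (Fin 3) → EuclideanSpace ℝ (Fin 3), IsTypeIAncientMild C u →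
      (∀ t < 0, ∀ x, ‖x‖ ≤ R * Real.sqrt (-t) → curl (u t) x ≠ 0 → stretchW u t x ≤ 1 - ε) →
      ∀ t < 0, ∀ x, u t x = 0

/-- §T1/§D2. **Far-past inner subcriticality** — the honest residual of lever C once the Gaussian
certificate is in hand (X-strength; with `GaussianStretchingCertificate`, the landed
`BackwardEndVanishing` and blow-down it implies `X`): every element is EVENTUALLY (towards `−∞`)
`ε`-subcritical on the inner paraboloid about some centre. Equivalent to "every blow-down limit is
stretching-subcritical on its inner paraboloid", i.e. a statement about tangent flows at `−∞` — the
object on which all three registered lines died. No mechanism identified at large `C`. -/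
def FarPastInnerSubcriticality : Prop :=
  ∀ C : ℝ, ∃ ε : ℝ, 0 < ε ∧ ∀ R : ℝ, 0 < R →
    ∀ u : ℝ → EuclideanSpace ℝ (Fin 3) → EuclideanSpace ℝ (Fin 3), IsTypeIAncientMild C u →
      ∃ (x₀ : EuclideanSpace ℝ (Fin 3)) (T : ℝ), T ≤ 0 ∧
        ∀ t < T, ∀ x, ‖x - x₀‖ ≤ R * Real.sqrt (-t) → curl (u t) x ≠ 0 → stretchW u t x ≤ 1 - ε

/-- §D1 bottom rung. **Recurrent selection** (provable, S–M: `A_C` is compact metrisable in `C_loc`,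
the parabolic scalings `u ↦ k u(k²·, k·)` act continuously (`isTypeIAncientMild_zoom`), the blow-down
limits of a non-zero element are non-zero (persistence, landed in the blow-down-census currency), and a
compact invariant set of a continuous flow contains a recurrent point — Birkhoff): a non-zero element of
`A_C` yields a non-zero element which is SCALING-RECURRENT along a sequence of scales `k_n → ∞`. -/
def RecurrentSelection : Prop :=
  ∀ C : ℝ, ∀ u : ℝ → EuclideanSpace ℝ (Fin 3) → EuclideanSpace ℝ (Fin 3), IsTypeIAncientMild C u →
    ¬ (∀ t < 0, ∀ x, u t x = 0) →
    ∃ v : ℝ → EuclideanSpace ℝ (Fin 3) → EuclideanSpace ℝ (Fin 3), IsTypeIAncientMild C v ∧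
      ¬ (∀ t < 0, ∀ x, v t x = 0) ∧
      ∃ k : ℕ → ℝ, (∀ n, 1 < k n) ∧ Tendsto k atTop atTop ∧
        ∀ t < 0, TendstoLocallyUniformly (fun n x => k n • v (k n ^ 2 * t) (k n • x)) (v t) atTop

/-- §D1 bottom rung. **Recurrent Liouville** (X-strength; contains Tsai's λ-DSS conjecture and
Pineau–Vicol's Conj. 1.1 in the rate class): a scaling-recurrent element of `A_C` vanishes. -/
def RecurrentLiouville : Prop :=
  ∀ C : ℝ, ∀ v : ℝ → EuclideanSpace ℝ (Fin 3) → EuclideanSpace ℝ (Fin 3), IsTypeIAncientMild C v →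
    (∃ k : ℕ → ℝ, (∀ n, 1 < k n) ∧ Tendsto k atTop atTop ∧
        ∀ t < 0, TendstoLocallyUniformly (fun n x => k n • v (k n ^ 2 * t) (k n • x)) (v t) atTop) →
    ∀ t < 0, ∀ x, v t x = 0

/-- The bottom rung composes to the target by pure logic (the content sits entirely in
`RecurrentLiouville`; `RecurrentSelection` is soft). -/
theorem typeIAncientLiouville_of_recurrent (hS : RecurrentSelection) (hL : RecurrentLiouville) :
    TypeIAncientLiouville := by
  intro C u hu
  by_contra hne
  obtain ⟨v, hv, hvne, k, hk1, hk, hrec⟩ := hS C u (isTypeIAncientMild_iff.2 hu) hne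
  exact hvne (hL C v hv ⟨k, hk1, hk, hrec⟩)

end Summit.NavierStokesRegularity.NavierStokesRegularity.Cruxes.ForcedSymmetry.StrategistSignatures

end
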